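import Literature.AlgebraicGeometry.Motives.MumfordTateGroupOfCMFamilyComplexPoints
import HarnessLib

/-!
# Galois-translated CM families have the same Hodge tensors: `⊕ᵢ V¹_{(Kᵢ,g⁻¹Φᵢ)}` and `⊕ᵢ V¹_{(Kᵢ,Φᵢ)}` have the SAME
# rational Hodge classes of every type `(p,p)` in every tensor space `T^{a,b}(E)`, hence the same Mumford–Tate and Hodge
# groups on all points, the same Mumford–Tate Lie algebra and rank (Deligne 1982 I Ex. 3.7 (c) «`Y(G)` is stable under
# `Gal(ℚ̄/ℚ)`» for the CM algebra `E = ∏ᵢ Kᵢ`; Pohlmann's criterion is Galois-invariant)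

Family `hodge`, lane `lit-hodgefound` (Track 2 foundations library; Layer A3/A4), topic `Literature/AlgebraicGeometry/Motives`,
namespace `Literature.AlgebraicGeometry.Motives.HodgeStructure`.  THEOREMS ONLY (no definition, no named fact; D-0026 net
debt `0`).  The CM-ALGEBRA form, and the extension to ALL types `(p,p)`, of the tree's single-field weight-`0` statements
`hodgeClasses_tensorSpace_ofCMType_eq_of_smul`, `mumfordTateLieAlgebra_ofCMType_eq_of_smul` (`Motives/MumfordTateRankOfCMType`)
and `mumfordTateGroupBaseChange_ofCMType_eq_of_smul` (`Motives/MumfordTateGroupOfCMTypeComplexPoints`).  Consumes BY NAME the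
seat's g19-#1 `Motives/MumfordTateGroupOfCMFamilyComplexPoints` (`hodgeTensorBasis_cmFamilyBasis_repr_smul`: the tensor
coordinates of RATIONAL tensors of `E` are `Aut(ℂ)`-equivariant), `Motives/HodgeStructureOfCMFamily` (`cmFamilyBasis`,
`cmFamilyDeg`, `ofCMFamily_F_eq_span`, `complexConj_ofCMFamily_F_eq_span`), `Motives/ZarhinHodgeGroupTypePP`
(`tensorSpaceToBaseChange_mem_span_degree_eq`), `Motives/ExtendedMumfordTateGroup` (`mem_hodgeClasses_of_mem_span_degree`),
`Motives/MumfordTateRankOfCMType` (`cmTypeSmul`), and the membership lemmas of `Motives/EtaleTate`, `…/HodgeTensor`,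
`…/HodgeStructureDeligneTorusMumfordTate`, `…/AtypicalHodgeLocus` (`mtRank`).

THE PRINT.  P. Deligne (notes by J. S. Milne), *Hodge cycles on abelian varieties*, LNM 900 (1982) [Deligne1982HodgeCycles],
I Example 3.7 (held re-edition `paper:doi-10-1007-978-3-540-38955-2-3` p0026 L31), VERBATIM: «(c) `Y(G)` is stable under
`Gal(ℚ̄/ℚ)`; thus `Y(G)` is the `Gal(ℚ̄/ℚ)`-module generated by `μ`» — so the torus `G ⊂ E^× × ℚ^×` attached to the CM type
`Σ` of the CM algebra `E` coincides with the one attached to any Galois translate `τΣ` (`Gal·μ_{τΣ} = Gal·μ_Σ`).  H. Pohlmann,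
*Algebraic cycles on abelian varieties of complex multiplication type*, Ann. of Math. 88 (1968) [Pohlmann1968], Thm. 1: the
criterion for a monomial in the eigen-coordinates to carry a rational class is a condition on its GALOIS ORBIT, hence invariant
under translating the type.  (The dictionary `deg_Φ(g • y) = deg_{g⁻¹Φ}(y)` is Dodson's `Φᵍ`, [Dodson1987] §1.1 p. 50.)

THE MECHANISM.  A rational tensor `t ∈ T^{a,b}(E)`, `a - b = 2p`, is a Hodge class of type `(p,p)` for `⊕ᵢ V¹_{(Kᵢ,Φᵢ)}`
iff its non-zero tensor coordinates (in the eigen-basis `E_y`, `y ∈ S^a × S^b`, `S = ⊔ᵢ Hom(Kᵢ, ℂ)`) sit at indices of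
degree `deg_Φ(y) = p` (§2, from `F^p ∩ F̄^p = span {E_y | deg y = p}`); the coordinates of a RATIONAL tensor satisfy
`coord_{g•y} = g(coord_y)`, so the support is `Aut(ℂ)`-stable; and `deg_Φ(g • y) = deg_{g⁻¹Φ}(y)` (§1).  Hence the Hodge
classes for `Φ` and for `g⁻¹Φ = (g⁻¹Φᵢ)ᵢ` coincide (§2), and with them every group / Lie algebra DEFINED as a fixer /
annihilator of Hodge tensors (§3).

WHAT IS PROVED.
* §1 `tensorDegree_cmFamilyDeg_smul` (`deg_Φ(g • y) = deg_Ψ(y)` for `Ψᵢ = g⁻¹Φᵢ`).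
* §2 **`mem_hodgeClasses_tensorSpace_ofCMFamily_iff_tensorDegree_eq`** (type `(p,p)` classes in coordinates, all `p`),
  **`hodgeClasses_tensorSpace_ofCMFamily_eq_of_smul`** (same Hodge tensors of every type for `Ψ = g⁻¹Φ`).
* §3 **`mumfordTateGroupBaseChange_ofCMFamily_eq_of_smul`**, **`hodgeGroupBaseChange_ofCMFamily_eq_of_smul`** (every field `L`),
  `mumfordTateGroup_ofCMFamily_eq_of_smul`, `hodgeGroup_ofCMFamily_eq_of_smul` (`ℚ`-points), `mumfordTateLieAlgebra_ofCMFamily_eq_of_smul`,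
  `mtRank_ofCMFamily_eq_of_smul`.
* §4 (CM fields, the tree's `cmTypeSmul g Φᵢ = gΦᵢ`) `hodgeClasses_tensorSpace_ofCMFamily_cmTypeSmul`,
  `mumfordTateGroupBaseChange_ofCMFamily_cmTypeSmul`, `hodgeGroupBaseChange_ofCMFamily_cmTypeSmul`, `mtRank_ofCMFamily_cmTypeSmul`.

NOT HERE: translating the `Φᵢ` by DIFFERENT `gᵢ` (changes the groups in general — e.g. `(Φ, Φ)` vs `(Φ, Φ̄)`); the
statement for the abelian varieties `∏ᵢ A_{Φᵢ}` vs `∏ᵢ A_{τΦᵢ} = τ(∏ᵢ A_{Φᵢ})` (transport along `HodgeTheory/CMBettiModel`);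
Deligne's theorem that Hodge cycles on abelian varieties are absolutely Hodge (of which this is the CM shadow).

## References
* [Deligne1982HodgeCycles] P. Deligne, *Hodge cycles on abelian varieties*, in LNM 900 (1982) — I §3 (proof of Prop. 3.4),
  Example 3.7 (c).
* [Pohlmann1968] H. Pohlmann, Ann. of Math. (2) 88 (1968) 161–180 — Thm. 1.
* [Dodson1987] B. Dodson, J. Algebra 111 (1987) — §1.1 (p. 50).
* [GreenGriffithsKerr2012] M. Green, P. A. Griffiths, M. Kerr, *Mumford–Tate Groups and Domains* (2012) — §I.B (I.B.1) (`M_φ`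
  as the fixer of the Hodge tensors).

## Provenance
Lane `lit-hodgefound` (Hodge path, Track 2), prover seat `lit-hodgefound-p29` (generation 19), self-proposed row g19-#4 (the
group-level translate invariance for families, companion of g19-#1's `T_Σ(ℂ)`, which visibly depends only on `Aut(ℂ)·Σ`).
-/

noncomputable section

open scoped TensorProduct Classical Pointwise
open Module NumberField

namespace Literature.AlgebraicGeometry.Motives

namespace HodgeStructure

open RealMult (embCoords)
open Literature.NumberTheory.ComplexMultiplication
open Literature.AlgebraicGeometry.Pohlmann1968 (CMAlgebra.familyType CMAlgebra.mem_familyType_iff CMAlgebra.smul_sigma_mk)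

variable {I : Type} [Fintype I] [DecidableEq I] {K : I → Type} [∀ i, Field (K i)] [∀ i, NumberField (K i)]

/-! ### §1 Degrees of translated indices -/

omit [Fintype I] [DecidableEq I] [∀ i, NumberField (K i)] in
/-- **The degree of a translated index is the degree for the translated family**: for `g ∈ Aut(ℂ)` and families of CM
types `Φ`, `Ψ` with `Ψᵢ = g⁻¹Φᵢ` for all `i`, `deg_Φ(g • y) = deg_Ψ(y)` — `𝟙_Σ(g • s) = 𝟙_{g⁻¹Σ}(s)` slot by slot, summed over
the index (single-field case: the tree's `tensorDegree_cmDeg_smul`). [cite: Dodson1987, §1.1 (p. 50)] -/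
theorem tensorDegree_cmFamilyDeg_smul (g : ℂ ≃+* ℂ) (Φ Ψ : ∀ i, CMType (K i)) (hΨ : ∀ i, (Ψ i).1 = g⁻¹ • (Φ i).1)
    {a b : ℕ} (y : (Fin a → (i : I) × (K i →+* ℂ)) × (Fin b → (i : I) × (K i →+* ℂ))) :
    tensorDegree (cmFamilyDeg Φ) (g • y) = tensorDegree (cmFamilyDeg Ψ) y := by
  have key : ∀ s : (i : I) × (K i →+* ℂ), cmFamilyDeg Φ (g • s) = cmFamilyDeg Ψ s := by
    rintro ⟨i, σ⟩
    rw [CMAlgebra.smul_sigma_mk, cmFamilyDeg_apply, cmFamilyDeg_apply]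
    change cmDeg (Φ i) (g • σ) = cmDeg (Ψ i) σ
    by_cases h : g • σ ∈ (Φ i).1
    · rw [cmDeg_of_mem (Φ i) h, cmDeg_of_mem (Ψ i) (by rw [hΨ i, Set.mem_inv_smul_set_iff]; exact h)]
    · rw [cmDeg_of_notMem (Φ i) h, cmDeg_of_notMem (Ψ i) (by rw [hΨ i, Set.mem_inv_smul_set_iff]; exact h)]
  simp only [tensorDegree_apply, Prod.smul_fst, Prod.smul_snd, Pi.smul_apply, key]

/-! ### §2 Hodge classes of type `(p,p)` in coordinates; Galois-translated families have the same Hodge tensors -/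

variable [HodgeTensorFacts.{0, 0}]

/-- **Hodge classes of type `(p,p)` in coordinates**: a rational tensor `t ∈ T^{a,b}(E)`, `a - b = 2p`, is a Hodge class of type
`(p,p)` for `⊕ᵢ V¹_{(Kᵢ,Φᵢ)}` iff every index `y` carrying a non-zero tensor coordinate of `ι t` has degree `Σₖ 𝟙_Σ(sₖ) - Σₗ 𝟙_Σ(tₗ)
= p` — the eigen-basis is adapted to the Hodge filtration (`ofCMFamily_F_eq_span`), so a rational tensor of type `(p,p)`
complexifies into `F^p ∩ F̄^p = span {E_y | deg y = p}` (the tree's `tensorSpaceToBaseChange_mem_span_degree_eq` /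
`mem_hodgeClasses_of_mem_span_degree`; the case `p = 0` is `mem_hodgeClasses_tensorSpace_ofCMFamily_iff`).
[cite: Deligne1982HodgeCycles, I §3 proof of Prop. 3.4 and Example 3.7 (p. 26)] [cite: Pohlmann1968, Thm. 1] -/
theorem mem_hodgeClasses_tensorSpace_ofCMFamily_iff_tensorDegree_eq (Φ : ∀ i, CMType (K i)) {a b : ℕ} {p : ℤ}
    (hab : ((a : ℤ) - b) * 1 = 2 * p) (t : hodgeTensorSpace (∀ i, K i) a b) :
    t ∈ ((ofCMFamily Φ).tensorSpace a b).hodgeClasses p ↔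
      ∀ y, (hodgeTensorBasis (cmFamilyBasis K) a b).repr (tensorSpaceToBaseChange ℂ (∀ i, K i) a b t) y ≠ 0 →
        tensorDegree (cmFamilyDeg Φ) y = p := by
  constructor
  · intro ht y hy
    have h := tensorSpaceToBaseChange_mem_span_degree_eq (ofCMFamily Φ) (cmFamilyBasis K) (ofCMFamily_F_eq_span Φ)
      (complexConj_ofCMFamily_F_eq_span Φ) hab ht
    rw [(hodgeTensorBasis (cmFamilyBasis K) a b).mem_span_image] at h
    exact h (by rw [Finset.mem_coe, Finsupp.mem_support_iff]; exact hy)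
  · intro h
    refine mem_hodgeClasses_of_mem_span_degree (ofCMFamily Φ) (cmFamilyBasis K) (ofCMFamily_F_eq_span Φ) ?_
    rw [(hodgeTensorBasis (cmFamilyBasis K) a b).mem_span_image]
    intro y hy
    rw [Finset.mem_coe, Finsupp.mem_support_iff] at hy
    exact h y hy

/-- **Galois-translated CM families have the SAME rational Hodge tensors of every type `(p,p)`**: for `g ∈ Aut(ℂ)` and
`Ψᵢ = g⁻¹Φᵢ` (all `i`), the Hodge classes of type `(p,p)` in `T^{a,b}(E)`, `a - b = 2p`, for `⊕ᵢ V¹_{(Kᵢ,Ψᵢ)}` and for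
`⊕ᵢ V¹_{(Kᵢ,Φᵢ)}` COINCIDE — a rational tensor has `Aut(ℂ)`-equivariant tensor coordinates (the tree's
`hodgeTensorBasis_cmFamilyBasis_repr_smul`), so its support is `Aut(ℂ)`-stable, and `deg_Φ(g • y) = deg_Ψ(y)`.  (Deligne (c):
«`Y(G)` is stable under `Gal(ℚ̄/ℚ)`»; Pohlmann's criterion is visibly Galois-invariant; the single-field weight-`0` case is the
tree's `hodgeClasses_tensorSpace_ofCMType_eq_of_smul`.) [cite: Deligne1982HodgeCycles, I Example 3.7 (c) (p. 26)]
[cite: Pohlmann1968, Thm. 1] -/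
theorem hodgeClasses_tensorSpace_ofCMFamily_eq_of_smul (g : ℂ ≃+* ℂ) (Φ Ψ : ∀ i, CMType (K i))
    (hΨ : ∀ i, (Ψ i).1 = g⁻¹ • (Φ i).1) {a b : ℕ} {p : ℤ} (hab : ((a : ℤ) - b) * 1 = 2 * p) :
    ((ofCMFamily Ψ).tensorSpace a b).hodgeClasses p = ((ofCMFamily Φ).tensorSpace a b).hodgeClasses p := by
  ext t
  rw [mem_hodgeClasses_tensorSpace_ofCMFamily_iff_tensorDegree_eq Ψ hab,
    mem_hodgeClasses_tensorSpace_ofCMFamily_iff_tensorDegree_eq Φ hab]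
  constructor
  · intro h y hy
    have key := h (g⁻¹ • y) (by
      rw [hodgeTensorBasis_cmFamilyBasis_repr_smul]
      exact (map_ne_zero_iff _ (g⁻¹ : ℂ ≃+* ℂ).injective).2 hy)
    rwa [← tensorDegree_cmFamilyDeg_smul g Φ Ψ hΨ (g⁻¹ • y), smul_inv_smul] at key
  · intro h y hy
    have key := h (g • y) (by
      rw [hodgeTensorBasis_cmFamilyBasis_repr_smul]
      exact (map_ne_zero_iff _ (g : ℂ ≃+* ℂ).injective).2 hy)
    rwa [tensorDegree_cmFamilyDeg_smul g Φ Ψ hΨ] at key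

/-! ### §3 … hence the same Mumford–Tate and Hodge groups (all points), Lie algebra and rank -/

/-- **`MT(⊕ᵢ V¹_{(Kᵢ,g⁻¹Φᵢ)})(L) = MT(⊕ᵢ V¹_{(Kᵢ,Φᵢ)})(L)` for every field `L ⊇ ℚ`**: both are the fixers of the same rational
Hodge tensors of weight `0` and type `(0,0)` (Deligne (c): the Mumford–Tate group of the CM algebra `(E, Σ)` depends only
on the Galois orbit of `Σ`; the abelian varieties `A_Σ` and its conjugate `A_{τΣ} = τA_Σ` have the same Mumford–Tate group).
Single-field case: the tree's `mumfordTateGroupBaseChange_ofCMType_eq_of_smul`. [cite: Deligne1982HodgeCycles, I Example 3.7 (c) (p. 26)] -/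
theorem mumfordTateGroupBaseChange_ofCMFamily_eq_of_smul (L : Type*) [Field L] [Algebra ℚ L] (g : ℂ ≃+* ℂ)
    (Φ Ψ : ∀ i, CMType (K i)) (hΨ : ∀ i, (Ψ i).1 = g⁻¹ • (Φ i).1) :
    (ofCMFamily Ψ).mumfordTateGroupBaseChange L = (ofCMFamily Φ).mumfordTateGroupBaseChange L := by
  ext γ
  rw [mem_mumfordTateGroupBaseChange_iff, mem_mumfordTateGroupBaseChange_iff]
  refine ⟨fun h a b hab t ht => h a b hab t ?_, fun h a b hab t ht => h a b hab t ?_⟩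
  · rwa [hodgeClasses_tensorSpace_ofCMFamily_eq_of_smul g Φ Ψ hΨ (p := 0) (by rw [mul_zero]; exact hab)]
  · rwa [← hodgeClasses_tensorSpace_ofCMFamily_eq_of_smul g Φ Ψ hΨ (p := 0) (by rw [mul_zero]; exact hab)]

/-- **`Hg(⊕ᵢ V¹_{(Kᵢ,g⁻¹Φᵢ)})(L) = Hg(⊕ᵢ V¹_{(Kᵢ,Φᵢ)})(L)` for every field `L ⊇ ℚ`** (fixers of the same Hodge tensors of
all types `(p,p)`). [cite: Deligne1982HodgeCycles, I Example 3.7 (c) (p. 26)] [cite: GreenGriffithsKerr2012, §I.B (I.B.1)] -/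
theorem hodgeGroupBaseChange_ofCMFamily_eq_of_smul (L : Type*) [Field L] [Algebra ℚ L] (g : ℂ ≃+* ℂ)
    (Φ Ψ : ∀ i, CMType (K i)) (hΨ : ∀ i, (Ψ i).1 = g⁻¹ • (Φ i).1) :
    (ofCMFamily Ψ).hodgeGroupBaseChange L = (ofCMFamily Φ).hodgeGroupBaseChange L := by
  ext γ
  rw [mem_hodgeGroupBaseChange_iff, mem_hodgeGroupBaseChange_iff]
  refine ⟨fun h a b p hp t ht => h a b p hp t ?_, fun h a b p hp t ht => h a b p hp t ?_⟩
  · rwa [hodgeClasses_tensorSpace_ofCMFamily_eq_of_smul g Φ Ψ hΨ hp]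
  · rwa [← hodgeClasses_tensorSpace_ofCMFamily_eq_of_smul g Φ Ψ hΨ hp]

/-- **`MT(⊕ᵢ V¹_{(Kᵢ,g⁻¹Φᵢ)})(ℚ) = MT(⊕ᵢ V¹_{(Kᵢ,Φᵢ)})(ℚ)`** (the Tannaka-free groups of `ℚ`-points).
[cite: Deligne1982HodgeCycles, I Example 3.7 (c) (p. 26)] -/
theorem mumfordTateGroup_ofCMFamily_eq_of_smul (g : ℂ ≃+* ℂ) (Φ Ψ : ∀ i, CMType (K i))
    (hΨ : ∀ i, (Ψ i).1 = g⁻¹ • (Φ i).1) :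
    (ofCMFamily Ψ).mumfordTateGroup = (ofCMFamily Φ).mumfordTateGroup := by
  ext γ
  rw [mem_mumfordTateGroup_iff, mem_mumfordTateGroup_iff]
  refine ⟨fun h a b hab t ht => h a b hab t ?_, fun h a b hab t ht => h a b hab t ?_⟩
  · rwa [hodgeClasses_tensorSpace_ofCMFamily_eq_of_smul g Φ Ψ hΨ (p := 0) (by rw [mul_zero]; exact hab)]
  · rwa [← hodgeClasses_tensorSpace_ofCMFamily_eq_of_smul g Φ Ψ hΨ (p := 0) (by rw [mul_zero]; exact hab)]

/-- **`Hg(⊕ᵢ V¹_{(Kᵢ,g⁻¹Φᵢ)})(ℚ) = Hg(⊕ᵢ V¹_{(Kᵢ,Φᵢ)})(ℚ)`** (the Tannaka-free groups of `ℚ`-points).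
[cite: Deligne1982HodgeCycles, I Example 3.7 (c) (p. 26)] [cite: GreenGriffithsKerr2012, §I.B (I.B.1)] -/
theorem hodgeGroup_ofCMFamily_eq_of_smul (g : ℂ ≃+* ℂ) (Φ Ψ : ∀ i, CMType (K i))
    (hΨ : ∀ i, (Ψ i).1 = g⁻¹ • (Φ i).1) :
    (ofCMFamily Ψ).hodgeGroup = (ofCMFamily Φ).hodgeGroup := by
  ext γ
  rw [mem_hodgeGroup_iff, mem_hodgeGroup_iff]
  refine ⟨fun h a b p hp t ht => h a b p hp t ?_, fun h a b p hp t ht => h a b p hp t ?_⟩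
  · rwa [hodgeClasses_tensorSpace_ofCMFamily_eq_of_smul g Φ Ψ hΨ hp]
  · rwa [← hodgeClasses_tensorSpace_ofCMFamily_eq_of_smul g Φ Ψ hΨ hp]

/-- **`𝔪𝔱(⊕ᵢ V¹_{(Kᵢ,g⁻¹Φᵢ)}) = 𝔪𝔱(⊕ᵢ V¹_{(Kᵢ,Φᵢ)})`** — the Mumford–Tate Lie algebras (annihilators of the weight-`0`
rational tensors of type `(0,0)`) coincide; single-field case: the tree's `mumfordTateLieAlgebra_ofCMType_eq_of_smul`.
[cite: Deligne1982HodgeCycles, I Example 3.7 (c) (p. 26)] -/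
theorem mumfordTateLieAlgebra_ofCMFamily_eq_of_smul (g : ℂ ≃+* ℂ) (Φ Ψ : ∀ i, CMType (K i))
    (hΨ : ∀ i, (Ψ i).1 = g⁻¹ • (Φ i).1) :
    (ofCMFamily Ψ).mumfordTateLieAlgebra = (ofCMFamily Φ).mumfordTateLieAlgebra := by
  ext X
  simp only [mem_mumfordTateLieAlgebra_iff]
  refine ⟨fun h a b hab t ht => h a b hab t ?_, fun h a b hab t ht => h a b hab t ?_⟩
  · rwa [hodgeClasses_tensorSpace_ofCMFamily_eq_of_smul g Φ Ψ hΨ (p := 0) (by rw [mul_zero]; exact hab)]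
  · rwa [← hodgeClasses_tensorSpace_ofCMFamily_eq_of_smul g Φ Ψ hΨ (p := 0) (by rw [mul_zero]; exact hab)]

/-- **`dim MT(⊕ᵢ V¹_{(Kᵢ,g⁻¹Φᵢ)}) = dim MT(⊕ᵢ V¹_{(Kᵢ,Φᵢ)})`** (`mtRank`; with the tree's `mtRank_ofCMFamily_eq_cmFamilyRank`
this is the invariance of the rank of the family under Galois translation). [cite: Deligne1982HodgeCycles, I Example 3.7 (c) (p. 26)]
[cite: Dodson1987, §1.1 (p. 50)] -/
theorem mtRank_ofCMFamily_eq_of_smul (g : ℂ ≃+* ℂ) (Φ Ψ : ∀ i, CMType (K i)) (hΨ : ∀ i, (Ψ i).1 = g⁻¹ • (Φ i).1) :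
    (ofCMFamily Ψ).mtRank = (ofCMFamily Φ).mtRank := by
  unfold mtRank
  rw [mumfordTateLieAlgebra_ofCMFamily_eq_of_smul g Φ Ψ hΨ]

/-! ### §4 CM fields: the translated family `(g • Φᵢ)ᵢ` (`cmTypeSmul`) -/

section CMField

variable [∀ i, IsCMField (K i)]

/-- For CM fields: the Hodge tensors of `⊕ᵢ V¹_{(Kᵢ,gΦᵢ)}` (`cmTypeSmul g (Φ i)`) are those of `⊕ᵢ V¹_{(Kᵢ,Φᵢ)}`.
[cite: Deligne1982HodgeCycles, I Example 3.7 (c) (p. 26)] -/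
theorem hodgeClasses_tensorSpace_ofCMFamily_cmTypeSmul (g : ℂ ≃+* ℂ) (Φ : ∀ i, CMType (K i)) {a b : ℕ} {p : ℤ}
    (hab : ((a : ℤ) - b) * 1 = 2 * p) :
    ((ofCMFamily fun i => cmTypeSmul g (Φ i)).tensorSpace a b).hodgeClasses p =
      ((ofCMFamily Φ).tensorSpace a b).hodgeClasses p :=
  hodgeClasses_tensorSpace_ofCMFamily_eq_of_smul g⁻¹ Φ (fun i => cmTypeSmul g (Φ i))
    (fun i => by rw [cmTypeSmul_val, inv_inv]) hab

/-- For CM fields: `MT(⊕ᵢ V¹_{(Kᵢ,gΦᵢ)})(L) = MT(⊕ᵢ V¹_{(Kᵢ,Φᵢ)})(L)` for every field `L`.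
[cite: Deligne1982HodgeCycles, I Example 3.7 (c) (p. 26)] -/
theorem mumfordTateGroupBaseChange_ofCMFamily_cmTypeSmul (L : Type*) [Field L] [Algebra ℚ L] (g : ℂ ≃+* ℂ)
    (Φ : ∀ i, CMType (K i)) :
    (ofCMFamily fun i => cmTypeSmul g (Φ i)).mumfordTateGroupBaseChange L = (ofCMFamily Φ).mumfordTateGroupBaseChange L :=
  mumfordTateGroupBaseChange_ofCMFamily_eq_of_smul L g⁻¹ Φ (fun i => cmTypeSmul g (Φ i))
    fun i => by rw [cmTypeSmul_val, inv_inv]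

/-- For CM fields: `Hg(⊕ᵢ V¹_{(Kᵢ,gΦᵢ)})(L) = Hg(⊕ᵢ V¹_{(Kᵢ,Φᵢ)})(L)` for every field `L`.
[cite: Deligne1982HodgeCycles, I Example 3.7 (c) (p. 26)] -/
theorem hodgeGroupBaseChange_ofCMFamily_cmTypeSmul (L : Type*) [Field L] [Algebra ℚ L] (g : ℂ ≃+* ℂ)
    (Φ : ∀ i, CMType (K i)) :
    (ofCMFamily fun i => cmTypeSmul g (Φ i)).hodgeGroupBaseChange L = (ofCMFamily Φ).hodgeGroupBaseChange L :=
  hodgeGroupBaseChange_ofCMFamily_eq_of_smul L g⁻¹ Φ (fun i => cmTypeSmul g (Φ i)) fun i => by rw [cmTypeSmul_val, inv_inv]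

/-- For CM fields: `dim MT(⊕ᵢ V¹_{(Kᵢ,gΦᵢ)}) = dim MT(⊕ᵢ V¹_{(Kᵢ,Φᵢ)})`. [cite: Deligne1982HodgeCycles, I Example 3.7 (c) (p. 26)] -/
theorem mtRank_ofCMFamily_cmTypeSmul (g : ℂ ≃+* ℂ) (Φ : ∀ i, CMType (K i)) :
    (ofCMFamily fun i => cmTypeSmul g (Φ i)).mtRank = (ofCMFamily Φ).mtRank :=
  mtRank_ofCMFamily_eq_of_smul g⁻¹ Φ (fun i => cmTypeSmul g (Φ i)) fun i => by rw [cmTypeSmul_val, inv_inv]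

end CMField

end HodgeStructure

end Literature.AlgebraicGeometry.Motives

end
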